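import Literature.NumberTheory.Automorphic.UnitaryGroupTruncatedKernelIntegrableOfSiegel
import Literature.NumberTheory.Automorphic.FiniteAdeleCompactValuationDepth
import HarnessLib

/-!
# Oscillation of a test function along `K_U`-conjugates of deep small CENTRAL elements over the torus Siegel set of
# `U(J₃)`: `‖f(x) − f(x · (tk)⁻¹ n(m v) (tk))‖ ≤ C_f · H(t)^{−1/[E:ℚ]}`
(Rogawski, *Automorphic Representations of Unitary Groups in Three Variables* (1990), §2.2 p. 13 and §7.2 Prop. 7.2.1,
p. 95 «absolutely integrable for every `T`»; Arthur, *A trace formula for reductive groups I*, Duke Math. J. 45 (1978),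
§8; Gelbart, *Automorphic forms on adele groups* (1975), (9.44)–(9.46))

Topic `NumberTheory/Automorphic`; namespace `Literature.NumberTheory.Automorphic.UnitaryGroup`. THEOREMS ONLY over accepted
tree modules (no definition, no named fact, no instance, no notation, no `sorry`). Brick (F5) of the row (L5-iii-b2)
(b2-β) «`|b_T| ∈ L¹(Z B_γ(F)∖G(𝔸))` for every `T`» of the T1-qs LAW 5 road of
`Cruxes/H413/Lines/F0_T1InnerFormTraceIdentity.lean` (cell `pub/hodgecm-mathlib`, crux H413): the OSCILLATION input of the
Riemann-sum estimate `|Σ_{w ∈ E⁻} F(a_t⁻¹ w + s) − covol⁻¹ ‖a_t‖ ∫ F| ≤ osc · ‖a_t‖ · vol ∕ covol` for the centre lattice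
sum of Rogawski's bracket `b_T` at the singular class `γ = d(a, b, a)` — here `F(y) = f(k⁻¹ γ u(x, y) k)` and the cells
are translates of `a_t⁻¹ · m𝓕⁻`, `a_t⁻¹ = (d₀⁻¹d₂)(t)`, so `osc` is the right modulus of continuity of `f` along the
elements `(t k)⁻¹ n(m v) (t k) = k⁻¹ n(a_t⁻¹ m v) k`, `v ∈ 𝓕̄⁻`. This is the CENTRAL sub-case of the oscillation row of
the ★ LAW 1 closer (`UnitaryGroupTruncatedKernelIntegrableOfSiegel`), assembled from the same ★ pieces in the quantifier
order the depth argument needs (directions FIRST, then level, then depth, then the compact of conjugated elements):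

* ★ `exists_isCompact_threeDirections_forall_threeFactor` — the compact direction set `S` and, for compact `KN, Ω`, the
  three-factor normal form `Ad((bk)⁻¹) u = exp(t₁X₁)exp(t₂X₂)exp(t₃X₃)·w`, `|tᵢ| ≤ C ρ(d(b))`, `w ∈ K(𝔫)`, for `u ∈ KN`
  whose conjugate `b⁻¹ u b` is `𝔫`-deep;
* ★ `IsQuasiSplitTest.exists_level_forall_norm_sub_conj_le` — the level `U` and the Lipschitz constant `L` of `f` along
  the directions of `S`; ★ `exists_principalCongruenceLevel_le_of_mem_finiteLevelsGL` — `K(𝔫) ≤ U`;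
* ★ (A1)(A2) `exists_finset_nat_forall_valued_le_of_isCompact` ∕ `exists_natCast_valued_mul_exp_le`
  (`FiniteAdeleCompactValuationDepth`) — THE DEPTH (§1): a natural number `m ≠ 0` making `m · P` `𝔫`-deep at every finite
  place for a compact `P ⊆ 𝔸_E` (here `P = R₂ · 𝓕̄⁻`, `R₂` the compact of root values `d₀⁻¹d₂` on the torus Siegel
  set above height `1`, ★ `exists_torusSiegelSet`);
* ★ `umat_conjBy` ∕ ★ `mat_heisElt` — the entries of `t⁻¹ n(w) t = n((d₀⁻¹d₂) w)` (§2);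
* ★ GLUE `exists_rootNorms_le_rpow_of_balance` (`UnitaryGroupSiegelRootNormDecay`) — `ρ(d(t)) ≤ κ′ H(t)^{−1/[E:ℚ]}` on the
  torus Siegel set from its BALANCE clause.

RESULT (§3) **`IsQuasiSplitTest.exists_forall_norm_sub_conj_center_le_rpow`**: for `f ∈ C_c^∞(U(J₃)(𝔸_F))`, a set `ST` of
torus elements with the root-compactum clause `hroot` and the BALANCE clause `hbal` of ★ `exists_torusSiegelSet`, and a
compact `V ⊆ 𝔸_E⁻`, there are `m : ℕ`, `m ≠ 0`, and `C ≥ 0` with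
`‖f x − f (x · ((t k)⁻¹ · n(m • v) · (t k)))‖ ≤ C · H(t)^{−1/[E:ℚ]}` for all `t ∈ ST` of height `≥ 1`, all `k ∈ K_U`,
`v ∈ V`, `x ∈ G(𝔸_F)` (`n(y) = heisElt hc 0 y`, the centre of the Heisenberg group).

## References
* J. D. Rogawski, *Automorphic Representations of Unitary Groups in Three Variables*, Ann. of Math. Stud. 123 (1990), §2.2
  (p. 13), §7.2 Prop. 7.2.1 (pp. 93–95) [Rogawski1990].
* J. Arthur, *A trace formula for reductive groups I*, Duke Math. J. 45 (1978), §8 [Arthur1978TraceFormulaI].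
* S. Gelbart, *Automorphic forms on adele groups*, Ann. of Math. Stud. 83 (1975), §9.B (9.44)–(9.46) [Gelbart1975].
* J. W. S. Cassels, A. Fröhlich (eds.), *Algebraic Number Theory* (1967), Ch. II §16 [CasselsFrohlichANT1967].
-/

set_option autoImplicit false

noncomputable section

open MeasureTheory NumberField IsDedekindDomain Set WithZero
open scoped NNReal Pointwise

namespace Literature.NumberTheory.Automorphic

namespace UnitaryGroup

variable {F E : Type} [Field F] [NumberField F] [Field E] [NumberField E] [Algebra F E]
  {c : E ≃ₐ[F] E}

/-! ## §1 The depth: a natural number `m` making `m · P` deep at every finite place -/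

section Depth

omit [NumberField F] [Algebra F E] in
/-- `|𝔫|_v ≠ 0`. [folklore] -/
private theorem idealRadius_ne_zero₅ (v : HeightOneSpectrum (𝓞 E)) (𝔫 : Ideal (𝓞 E)) : idealRadius E v 𝔫 ≠ 0 := by
  unfold idealRadius
  exact WithZero.exp_ne_zero

omit [NumberField F] [Algebra F E] in
/-- **THE DEPTH.** For a compact `P ⊆ 𝔸_E` and `𝔫 ≠ 0` there is a natural number `m ≠ 0` with
`|m|_v · |x_v|_v ≤ |𝔫|_v` at every finite place `v`, for every `x ∈ P` (★ (A1): the finite shadow of `P` has bounded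
valuations, `≤ 1` off a finite `T`; ★ (A2) with `T ∪ supp 𝔫` and radii `|𝔫|_v`; off `T ∪ supp 𝔫` both factors are `≤ 1 = |𝔫|_v`).
[cite: CasselsFrohlichANT1967, Ch. II §16] -/
theorem exists_nat_forall_valued_natCast_mul_le_idealRadius {P : Set (AdeleRing (𝓞 E) E)} (hP : IsCompact P)
    {𝔫 : Ideal (𝓞 E)} (h𝔫 : 𝔫 ≠ 0) :
    ∃ m : ℕ, m ≠ 0 ∧ ∀ x ∈ P, ∀ v : HeightOneSpectrum (𝓞 E),
      Valued.v ((m : v.adicCompletion E)) * Valued.v (x.2 v) ≤ idealRadius E v 𝔫 := by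
  classical
  -- the finite shadow of `P`
  have hC : IsCompact ((fun x : AdeleRing (𝓞 E) E => x.2) '' P) := hP.image continuous_snd
  obtain ⟨T, n, hT1, hTn⟩ := exists_finset_nat_forall_valued_le_of_isCompact (K := E) hC
  set T' : Finset (HeightOneSpectrum (𝓞 E)) := T ∪ (Ideal.finite_factors h𝔫).toFinset with hT'
  obtain ⟨m, hm0, hm1, hmT⟩ := exists_natCast_valued_mul_exp_le (K := E) T' n (fun v => idealRadius E v 𝔫)
    (fun v _ => idealRadius_ne_zero₅ v 𝔫)
  refine ⟨m, hm0, fun x hx v => ?_⟩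
  have hxC : x.2 ∈ (fun x : AdeleRing (𝓞 E) E => x.2) '' P := ⟨x, hx, rfl⟩
  by_cases hv : v ∈ T'
  · exact (mul_le_mul' le_rfl (hTn _ hxC v)).trans (hmT v hv)
  · have hvT : v ∉ T := fun h => hv (by rw [hT']; exact Finset.mem_union_left _ h)
    have hv𝔫 : ¬ v.asIdeal ∣ 𝔫 := fun h => hv (by
      rw [hT']; exact Finset.mem_union_right _ ((Set.Finite.mem_toFinset _).2 h))
    rw [idealRadius_eq_one_of_not_dvd h𝔫 hv𝔫]
    exact mul_le_one' (hm1 v) (hT1 _ hxC v hvT)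

end Depth

/-! ## §2 The entries of the conjugate `t⁻¹ n(w) t = n((d₀⁻¹d₂) w)` of a central element by a torus element -/

section Entries

omit [NumberField F] in
/-- Components of a product of adeles at a finite place. [folklore] -/
private theorem snd_mul_apply₅ (a b : AdeleRing (𝓞 E) E) (v : HeightOneSpectrum (𝓞 E)) :
    (a * b).2 v = a.2 v * b.2 v := rfl

omit [NumberField F] in
/-- Components of the negative of an adele at a finite place. [folklore] -/
private theorem snd_neg_apply₅ (a : AdeleRing (𝓞 E) E) (v : HeightOneSpectrum (𝓞 E)) :
    (-a).2 v = -(a.2 v) := rfl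

/-- **THE ENTRIES OF `t⁻¹ n(w) t`.** For a torus element `t` (`torusPart t = t`) and `w ∈ 𝔸_E⁻`, if
`|((d₀⁻¹d₂)(t) · w)_v| ≤ |𝔫|_v` at every finite place, then every off-diagonal entry of `adelicVal (t⁻¹ n(w) t)` and its
conjugate has `v`-component of valuation `≤ |𝔫|_v` — the only non-zero off-diagonal entry is the corner
`d₀⁻¹ · w · d₂` (★ `umat_conjBy`, ★ `mat_heisElt`), and `c(d₀⁻¹d₂ w) = −d₀⁻¹d₂ w` (★ `conjAdele_torusCentralScalar`).
This is the premise `hval` of ★ `exists_isCompact_threeDirections_forall_threeFactor` for central `u`.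
[cite: Rogawski1990, §1.10, §2.2 (p. 13)] -/
theorem forall_valued_entry_torus_inv_mul_center_mul_le (hc : c * c = 1) {t : borelAdelic F E c 3}
    (ht : torusPart t = t) (w : traceZeroAdele F E c) {𝔫 : Ideal (𝓞 E)}
    (hw : ∀ v : HeightOneSpectrum (𝓞 E),
      Valued.v ((((((diagUnit t.2 0)⁻¹ * diagUnit t.2 2 : (AdeleRing (𝓞 E) E)ˣ)) : AdeleRing (𝓞 E) E) *
        (w : AdeleRing (𝓞 E) E)).2 v) ≤ idealRadius E v 𝔫) :
    ∀ i j : Fin 3, i ≠ j → ∀ v : HeightOneSpectrum (𝓞 E),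
      Valued.v ((((adelicVal F E c 3 _ ((t : (quasiSplit F E c 3).Adelic)⁻¹ *
          ((((heisElt hc 0 w : unipotentInBorel F E c 3) : borelAdelic F E c 3) : (quasiSplit F E c 3).Adelic)) *
          (t : (quasiSplit F E c 3).Adelic)) :
        GL (Fin 3) (AdeleRing (𝓞 E) E)) : Matrix (Fin 3) (Fin 3) (AdeleRing (𝓞 E) E)) i j).2 v) ≤
          idealRadius E v 𝔫 ∧
      Valued.v ((conjAdele F E c (((adelicVal F E c 3 _ ((t : (quasiSplit F E c 3).Adelic)⁻¹ *
          ((((heisElt hc 0 w : unipotentInBorel F E c 3) : borelAdelic F E c 3) : (quasiSplit F E c 3).Adelic)) *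
          (t : (quasiSplit F E c 3).Adelic)) :
        GL (Fin 3) (AdeleRing (𝓞 E) E)) : Matrix (Fin 3) (Fin 3) (AdeleRing (𝓞 E) E)) i j)).2 v) ≤
          idealRadius E v 𝔫 := by
  -- `t` as an element of `T(𝔸_F) ≤ B(𝔸_F)` and its diagonal
  set tT : torusInBorel F E c 3 := ⟨t, (mem_torusInBorel_iff_torusPart_eq t).2 ht⟩ with htT
  have hd := glDiagonal_diagUnit_torus tT
  -- the conjugate is `conjBy tT (n(w))`
  have hconj : (t : (quasiSplit F E c 3).Adelic)⁻¹ *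
      ((((heisElt hc 0 w : unipotentInBorel F E c 3) : borelAdelic F E c 3) : (quasiSplit F E c 3).Adelic)) *
      (t : (quasiSplit F E c 3).Adelic) =
      (((isTopSemidirect_borelAdelic.conjBy tT (heisElt hc 0 w) : unipotentInBorel F E c 3) :
        borelAdelic F E c 3) : (quasiSplit F E c 3).Adelic) := rfl
  -- the corner scalar is `c`-fixed and `w` is `c`-antifixed
  have hfix := conjAdele_torusCentralScalar tT hd
  have hwneg : conjAdele F E c (w : AdeleRing (𝓞 E) E) = -(w : AdeleRing (𝓞 E) E) := (mem_traceZeroAdele_iff _).1 w.2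
  have h0 : ∀ v : HeightOneSpectrum (𝓞 E), Valued.v ((0 : AdeleRing (𝓞 E) E).2 v) ≤ idealRadius E v 𝔫 := fun v => by
    have : (0 : AdeleRing (𝓞 E) E).2 v = 0 := rfl
    rw [this, map_zero]; exact zero_le
  -- the corner entry
  have hcorner : (((diagUnit t.2 0)⁻¹ : (AdeleRing (𝓞 E) E)ˣ) : AdeleRing (𝓞 E) E) * (w : AdeleRing (𝓞 E) E) *
      (diagUnit t.2 2 : AdeleRing (𝓞 E) E) =
      ((((diagUnit t.2 0)⁻¹ * diagUnit t.2 2 : (AdeleRing (𝓞 E) E)ˣ)) : AdeleRing (𝓞 E) E) * (w : AdeleRing (𝓞 E) E) := by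
    rw [Units.val_mul]; ring
  have hcornerc : conjAdele F E c (((((diagUnit t.2 0)⁻¹ * diagUnit t.2 2 : (AdeleRing (𝓞 E) E)ˣ)) : AdeleRing (𝓞 E) E) *
      (w : AdeleRing (𝓞 E) E)) =
      -(((((diagUnit t.2 0)⁻¹ * diagUnit t.2 2 : (AdeleRing (𝓞 E) E)ˣ)) : AdeleRing (𝓞 E) E) * (w : AdeleRing (𝓞 E) E)) := by
    rw [map_mul, hwneg, mul_neg]
    exact congrArg (fun z => -(z * (w : AdeleRing (𝓞 E) E))) hfix
  intro i j hij v
  rw [hconj, umat_conjBy tT hd (heisElt hc 0 w) i j, mat_heisElt hc]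
  -- case analysis on the entry
  fin_cases i <;> fin_cases j
  all_goals first
    | exact absurd rfl hij
    | (simp only [heisMatrix, heisZ, Matrix.of_apply, Matrix.cons_val', Matrix.cons_val_zero, Matrix.cons_val_one,
        Matrix.cons_val_two, Matrix.empty_val', Matrix.cons_val_fin_one, Matrix.head_cons, Matrix.tail_cons,
        Matrix.head_fin_const, mul_zero, zero_mul, map_zero, neg_zero, sub_zero, Fin.isValue, Fin.mk_one,
        Fin.zero_eta, Fin.reduceFinMk]
       first
        | exact ⟨h0 v, h0 v⟩
        | (rw [hcorner, hcornerc, snd_neg_apply₅, Valuation.map_neg]; exact ⟨hw v, hw v⟩))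

end Entries

/-! ## §3 The oscillation bound on the torus Siegel set -/

section Main

/-- **OSCILLATION OF A TEST FUNCTION ALONG `K_U`-CONJUGATES OF DEEP SMALL CENTRAL ELEMENTS ON THE TORUS SIEGEL SET.**
Let `f ∈ C_c^∞(U(J₃)(𝔸_F))` (`IsQuasiSplitTest`). Let `ST ⊆ B(𝔸_F)` consist of torus elements (`hSTt`) and satisfy the
ROOT-COMPACTUM clause `hroot` (`(d₀⁻¹d₂)(t) ∈ R₂` compact whenever `H(t) ≥ 1`) and the BALANCE clause `hbal` of ★
`exists_torusSiegelSet`; let `V ⊆ 𝔸_E⁻` be compact (the closure of a fundamental domain of `E⁻`). Then there are `m : ℕ`,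
`m ≠ 0`, and `C ≥ 0` such that for every `t ∈ ST` with `1 ≤ H(t)`, every `k ∈ K_U`, every `v ∈ V` and every `x`:
`‖f x − f (x · ((t k)⁻¹ · n(m • v) · (t k)))‖ ≤ C · H(t)^{−1/[E:ℚ]}`, `n(y) = heisElt hc 0 y` the centre of `N(𝔸_F)`.
(Directions ★ first; level `U ⊇ K(𝔫)` of `f`; depth `m` for `𝔫` on `R₂ · V` (§1); the compact `KN = n(m • V)`; three-factor
normal form ★ with `Ω = {1}` and §2; Lipschitz ★; GLUE ★ `ρ(d(t)) ≤ κ′ H(t)^{−1/[E:ℚ]}`.)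
[cite: Rogawski1990, §2.2 (p. 13), §7.2 Prop. 7.2.1 (p. 95)] [cite: Arthur1978TraceFormulaI, §8] [cite: Gelbart1975, §9.B (9.44)–(9.46)] -/
theorem IsQuasiSplitTest.exists_forall_norm_sub_conj_center_le_rpow (hc : c * c = 1)
    {f : (quasiSplit F E c 3).Adelic → ℂ} (hf : IsQuasiSplitTest F E c 3 f)
    {ST : Set (borelAdelic F E c 3)} (hSTt : ∀ t ∈ ST, torusPart t = t)
    {R₂ : Set (AdeleRing (𝓞 E) E)} (hR₂ : IsCompact R₂)
    (hroot : ∀ t ∈ ST, 1 ≤ borelHeight (t : (quasiSplit F E c 3).Adelic) →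
      (((diagUnit t.2 0)⁻¹ * diagUnit t.2 2 : (AdeleRing (𝓞 E) E)ˣ) : AdeleRing (𝓞 E) E) ∈ R₂)
    {κ : ℝ}
    (hbal : ∀ t ∈ ST, ∀ w : InfinitePlace E,
      ‖((((diagUnit t.2 0)⁻¹ * diagUnit t.2 1 : (AdeleRing (𝓞 E) E)ˣ) : AdeleRing (𝓞 E) E)).1 w‖ ≤
        κ * ((borelHeight (t : (quasiSplit F E c 3).Adelic) : ℝ) ^ (-(1 / (Module.finrank ℚ E : ℝ)))))
    {V : Set (traceZeroAdele F E c)} (hV : IsCompact V) :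
    ∃ m : ℕ, m ≠ 0 ∧ ∃ C : ℝ, 0 ≤ C ∧
      ∀ t ∈ ST, 1 ≤ borelHeight (t : (quasiSplit F E c 3).Adelic) →
      ∀ k : (quasiSplit F E c 3).Adelic, adelicVal F E c 3 _ k ∈ standardMaximalCompactGL 3 E →
      ∀ v ∈ V, ∀ x : (quasiSplit F E c 3).Adelic,
        ‖f x - f (x * (((t : (quasiSplit F E c 3).Adelic) * k)⁻¹ *
            ((((heisElt hc 0 (m • v) : unipotentInBorel F E c 3) : borelAdelic F E c 3) : (quasiSplit F E c 3).Adelic)) *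
            ((t : (quasiSplit F E c 3).Adelic) * k)))‖ ≤
          C * ((borelHeight (t : (quasiSplit F E c 3).Adelic) : ℝ) ^ (-(1 / (Module.finrank ℚ E : ℝ)))) := by
  classical
  -- directions first
  obtain ⟨S, hS, hgeomS⟩ := exists_isCompact_threeDirections_forall_threeFactor (F := F) (E := E) (c := c) hc
  -- the level and the Lipschitz constant of `f`
  obtain ⟨U, hU, L, hL0, hL⟩ := hf.exists_level_forall_norm_sub_conj_le hS
  obtain ⟨𝔫, h𝔫, hle, -⟩ :=
    exists_principalCongruenceLevel_le_of_mem_finiteLevelsGL (n := 3) (K := E) hU Filter.univ_mem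
  -- the depth on the compact `R₂ · V`
  have hP : IsCompact ((fun p : AdeleRing (𝓞 E) E × AdeleRing (𝓞 E) E => p.1 * p.2) ''
      (R₂ ×ˢ (((↑) : traceZeroAdele F E c → AdeleRing (𝓞 E) E) '' V))) :=
    (hR₂.prod (hV.image continuous_subtype_val)).image (continuous_fst.mul continuous_snd)
  obtain ⟨m, hm0, hm⟩ := exists_nat_forall_valued_natCast_mul_le_idealRadius (E := E) hP h𝔫
  -- the compact set of central elements `n(m • v)`, `v ∈ V`, and `Ω = {1}`
  set KN : Set (adelicUnipotent F E c 3) :=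
    (fun v : traceZeroAdele F E c => heisChart hc ((0 : AdeleRing (𝓞 E) E), m • v)) '' V with hKN
  have hKNc : IsCompact KN :=
    hV.image ((heisChart hc).continuous.comp (continuous_const.prodMk (continuous_nsmul m)))
  obtain ⟨C, hC0, hgeom⟩ := hgeomS hKNc (isCompact_singleton (x := (1 : adelicUnipotent F E c 3)))
  -- GLUE
  obtain ⟨κ', hκ'0, hglue⟩ := exists_rootNorms_le_rpow_of_balance (F := F) (E := E) (c := c)
    (Ω := {(1 : borelAdelic F E c 3)}) (ST := ST)
    (by intro b hb; rw [Set.mem_singleton_iff.1 hb]; exact (unipotentInBorel F E c 3).one_mem) hSTt hbal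
  refine ⟨m, hm0, 3 * L * (C * κ'), by positivity, fun t ht h1 k hk v hv x => ?_⟩
  -- the unipotent part of `t` is `1 ∈ Ω`
  have hΩ : (⟨(((torusPart t)⁻¹ * t : borelAdelic F E c 3) : (quasiSplit F E c 3).Adelic),
      torusPart_inv_mul_mem_adelicUnipotent t⟩ : adelicUnipotent F E c 3) ∈ ({1} : Set (adelicUnipotent F E c 3)) := by
    rw [Set.mem_singleton_iff]
    refine Subtype.ext ?_
    change (((torusPart t)⁻¹ * t : borelAdelic F E c 3) : (quasiSplit F E c 3).Adelic) = 1
    rw [hSTt t ht, inv_mul_cancel]; rfl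
  -- the depth condition for every `u ∈ KN`
  have hval : ∀ u ∈ KN, ∀ i j : Fin 3, i ≠ j → ∀ v : HeightOneSpectrum (𝓞 E),
      Valued.v ((((adelicVal F E c 3 _ ((t : (quasiSplit F E c 3).Adelic)⁻¹ *
          (u : (quasiSplit F E c 3).Adelic) * (t : (quasiSplit F E c 3).Adelic)) :
        GL (Fin 3) (AdeleRing (𝓞 E) E)) : Matrix (Fin 3) (Fin 3) (AdeleRing (𝓞 E) E)) i j).2 v) ≤
          idealRadius E v 𝔫 ∧
      Valued.v ((conjAdele F E c (((adelicVal F E c 3 _ ((t : (quasiSplit F E c 3).Adelic)⁻¹ *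
          (u : (quasiSplit F E c 3).Adelic) * (t : (quasiSplit F E c 3).Adelic)) :
        GL (Fin 3) (AdeleRing (𝓞 E) E)) : Matrix (Fin 3) (Fin 3) (AdeleRing (𝓞 E) E)) i j)).2 v) ≤
          idealRadius E v 𝔫 := by
    rintro u ⟨v', hv', rfl⟩
    rw [coe_heisChart]
    refine forall_valued_entry_torus_inv_mul_center_mul_le hc (hSTt t ht) (m • v') fun v => ?_
    -- `(d₀⁻¹d₂) · (m • v') = m · ((d₀⁻¹d₂) · v')` and the depth
    have hmem : ((((diagUnit t.2 0)⁻¹ * diagUnit t.2 2 : (AdeleRing (𝓞 E) E)ˣ)) : AdeleRing (𝓞 E) E) *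
        (v' : AdeleRing (𝓞 E) E) ∈ (fun p : AdeleRing (𝓞 E) E × AdeleRing (𝓞 E) E => p.1 * p.2) ''
          (R₂ ×ˢ (((↑) : traceZeroAdele F E c → AdeleRing (𝓞 E) E) '' V)) :=
      ⟨(_, _), ⟨hroot t ht h1, v', hv', rfl⟩, rfl⟩
    have heq : ((((diagUnit t.2 0)⁻¹ * diagUnit t.2 2 : (AdeleRing (𝓞 E) E)ˣ)) : AdeleRing (𝓞 E) E) *
        ((m • v' : traceZeroAdele F E c) : AdeleRing (𝓞 E) E) =
        (m : AdeleRing (𝓞 E) E) * (((((diagUnit t.2 0)⁻¹ * diagUnit t.2 2 : (AdeleRing (𝓞 E) E)ˣ)) : AdeleRing (𝓞 E) E) *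
          (v' : AdeleRing (𝓞 E) E)) := by
      rw [AddSubgroupClass.coe_nsmul, nsmul_eq_mul]; ring
    have hcast : ((m : AdeleRing (𝓞 E) E)).2 v = (m : v.adicCompletion E) := rfl
    rw [heq, snd_mul_apply₅, map_mul, hcast]
    exact hm _ hmem v
  -- the three-factor normal form for `u ∈ KN`, with `w ∈ K(𝔫) ≤ U`
  have hgeom' : ∀ u ∈ KN, ∃ (t₁ t₂ t₃ : ℝ) (X₁ X₂ X₃ : Matrix (Fin 3) (Fin 3) (mixedEmbedding.mixedSpace E))
      (w : GL (Fin 3) (AdeleRing (𝓞 E) E)),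
      X₁ ∈ S ∧ X₂ ∈ S ∧ X₃ ∈ S ∧ w ∈ U ∧
      |t₁| ≤ C * max (max
          ‖archHom E ((((diagUnit t.2 0)⁻¹ * diagUnit t.2 1 : (AdeleRing (𝓞 E) E)ˣ)) : AdeleRing (𝓞 E) E)‖
          ‖archHom E ((((diagUnit t.2 0)⁻¹ * diagUnit t.2 2 : (AdeleRing (𝓞 E) E)ˣ)) : AdeleRing (𝓞 E) E)‖)
          ‖archHom E ((((diagUnit t.2 1)⁻¹ * diagUnit t.2 2 : (AdeleRing (𝓞 E) E)ˣ)) : AdeleRing (𝓞 E) E)‖ ∧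
      |t₂| ≤ C * max (max
          ‖archHom E ((((diagUnit t.2 0)⁻¹ * diagUnit t.2 1 : (AdeleRing (𝓞 E) E)ˣ)) : AdeleRing (𝓞 E) E)‖
          ‖archHom E ((((diagUnit t.2 0)⁻¹ * diagUnit t.2 2 : (AdeleRing (𝓞 E) E)ˣ)) : AdeleRing (𝓞 E) E)‖)
          ‖archHom E ((((diagUnit t.2 1)⁻¹ * diagUnit t.2 2 : (AdeleRing (𝓞 E) E)ˣ)) : AdeleRing (𝓞 E) E)‖ ∧
      |t₃| ≤ C * max (max
          ‖archHom E ((((diagUnit t.2 0)⁻¹ * diagUnit t.2 1 : (AdeleRing (𝓞 E) E)ˣ)) : AdeleRing (𝓞 E) E)‖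
          ‖archHom E ((((diagUnit t.2 0)⁻¹ * diagUnit t.2 2 : (AdeleRing (𝓞 E) E)ˣ)) : AdeleRing (𝓞 E) E)‖)
          ‖archHom E ((((diagUnit t.2 1)⁻¹ * diagUnit t.2 2 : (AdeleRing (𝓞 E) E)ˣ)) : AdeleRing (𝓞 E) E)‖ ∧
      adelicVal F E c 3 _ ((((t : (quasiSplit F E c 3).Adelic) * k))⁻¹ * (u : (quasiSplit F E c 3).Adelic) *
          ((t : (quasiSplit F E c 3).Adelic) * k)) =
        GLn.ofInfinite 3 E (expGL (t₁ • X₁) * expGL (t₂ • X₂) * expGL (t₃ • X₃)) * w := by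
    intro u hu
    obtain ⟨t₁, t₂, t₃, X₁, X₂, X₃, w, hX₁, hX₂, hX₃, hw, ht₁, ht₂, ht₃, e⟩ :=
      hgeom t k hk hΩ 𝔫 u hu (hval u hu)
    exact ⟨t₁, t₂, t₃, X₁, X₂, X₃, w, hX₁, hX₂, hX₃, hle hw, ht₁, ht₂, ht₃, e⟩
  -- Lipschitz
  have key := hL ((t : (quasiSplit F E c 3).Adelic) * k) _ KN hgeom' x
    (heisChart hc ((0 : AdeleRing (𝓞 E) E), m • v)) ⟨v, hv, rfl⟩
  rw [coe_heisChart] at key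
  -- GLUE at `b = 1 * t * 1`
  have h1K : (1 : borelAdelic F E c 3) ∈ {k : borelAdelic F E c 3 | adelicVal F E c 3 ((StdForm.antidiagonal 3).over E)
        (k : (quasiSplit F E c 3).Adelic) ∈ standardMaximalCompactGL 3 E} := by
    simp only [Set.mem_setOf_eq, OneMemClass.coe_one, map_one]
    exact Subgroup.one_mem _
  have hmem : t ∈ ({(1 : borelAdelic F E c 3)} : Set (borelAdelic F E c 3)) * ST *
      {k : borelAdelic F E c 3 | adelicVal F E c 3 ((StdForm.antidiagonal 3).over E)
        (k : (quasiSplit F E c 3).Adelic) ∈ standardMaximalCompactGL 3 E} :=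
    Set.mem_mul.2 ⟨1 * t, Set.mul_mem_mul (Set.mem_singleton 1) ht, 1, h1K, by rw [one_mul, mul_one]⟩
  have hρ := hglue t hmem h1
  calc _ ≤ 3 * L * (C * _) := key
    _ ≤ 3 * L * (C * (κ' * ((borelHeight (t : (quasiSplit F E c 3).Adelic) : ℝ) ^
          (-(1 / (Module.finrank ℚ E : ℝ)))))) := by gcongr
    _ = 3 * L * (C * κ') * _ := by ring

end Main

end UnitaryGroup

end Literature.NumberTheory.Automorphic

end
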